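import Summits.CriticalPhenomena.PercolationContinuityZ3.Theorems.PercNearOneGluingNoHeavyLowerTailOneCutCertCheck

/-!
# `NoHeavyLowerTail` (crux stmt-CriticalPhenomena-4575), certificate programme for the one-cut bound at
# `|A| = 5`: soundness of the box-certificate checker

Layer 4b of the kernel-checked certificate checker (prim-cert-2).  `boxCheck_sound`: if
`boxCheck n o rel pairs φ s lam cc = true` then at every weight vector STRICTLY inside the box `φ`
with `E N > 4`, `P(1 ≤ N ≤ 2) ≤ t` whenever every listed relay–relay cut has probability `≤ t`.
The proof assembles the layers: the transformed integer tables are `2^m ·` the box restriction of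
the event tables (`boxTr_phiZ_eq`, `ML_box`, `real_sep_eq_ML`, `real_low_eq_ML`, `meanCount_eq_ML`),
the accepted digit test gives nonnegative fibre sums (`certCoefZ_nonneg_of_digit_ge`), hence a
nonnegative certificate form (`certForm_nonneg`), and `le_of_certificate` concludes.

Nothing here asserts anything about the crux.
-/

namespace Summit.CriticalPhenomena.PercolationContinuityZ3.Theorems.OneCutCert

open Finset MeasureTheory
open scoped BigOperators Classical
open Literature.Probability.Percolation Literature.Probability.LatticeModels
open Summit.CriticalPhenomena.PercolationContinuityZ3.Theorems.AdditiveGluing.Negative.Cert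

variable {n : ℕ}

/-! ## Soundness of the checker -/

/-- Corner weights are positive on the open cube. [folklore] -/
theorem mono_pos {m : ℕ} {x : Fin m → ℝ} (hx : ∀ i, 0 < x i ∧ x i < 1) (g : Fin m → Bool) : 0 < mono x g := by
  unfold mono
  refine Finset.prod_pos fun i _ => ?_
  split_ifs
  · exact (hx i).1
  · exact sub_pos.2 (hx i).2

/-- `tabOf` of a list of naturals is nonnegative. [this work] -/
theorem tabOf_natCast_nonneg {m : ℕ} (l : List ℕ) (g : Fin m → Bool) :
    0 ≤ tabOf (l.map ((↑) : ℕ → ℤ)) g := by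
  unfold tabOf
  rw [List.getD_eq_getElem?_getD, List.getElem?_map]
  cases l[enc2 g]? <;> simp

/-- A positive entry of a list table makes its `ML` positive on the open cube. [this work] -/
theorem ML_pos_of_entry {m : ℕ} (l : List ℕ) (hl : l.length = 2 ^ m) (hpos : ∃ x ∈ l, 0 < x)
    {u : Fin m → ℝ} (hu : ∀ i, 0 < u i ∧ u i < 1) :
    0 < ML (fun g => (tabOf (l.map ((↑) : ℕ → ℤ)) g : ℝ)) u := by
  obtain ⟨x, hx, hxpos⟩ := hpos
  obtain ⟨i, hi, rfl⟩ := List.getElem_of_mem hx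
  -- the corner with `enc2 g = i`
  have him : i < 2 ^ m := hl ▸ hi
  let g : Fin m → Bool := fun j => i.testBit j
  have hg : enc2 g = i := by
    apply Nat.eq_of_testBit_eq
    intro j
    by_cases hj : j < m
    · exact testBit_enc2 g ⟨j, hj⟩
    · rw [testBit_enc2_of_le g j (not_lt.1 hj), Nat.testBit_lt_two_pow]
      exact lt_of_lt_of_le him (Nat.pow_le_pow_right (by norm_num) (not_lt.1 hj))
  unfold ML
  have hterm : ∀ h ∈ (Finset.univ : Finset (Fin m → Bool)),
      0 ≤ (tabOf (l.map ((↑) : ℕ → ℤ)) h : ℝ) * mono u h := fun h _ =>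
    mul_nonneg (by exact_mod_cast tabOf_natCast_nonneg l h) (mono_nonneg (fun i => ⟨(hu i).1.le, (hu i).2.le⟩) h)
  refine lt_of_lt_of_le ?_ (Finset.single_le_sum hterm (Finset.mem_univ g))
  refine mul_pos ?_ (mono_pos hu g)
  unfold tabOf
  rw [hg, List.getD_eq_getElem?_getD, List.getElem?_map, List.getElem?_eq_getElem hi]
  simp only [Option.map_some, Option.getD_some]
  exact_mod_cast hxpos

/-- `maxAbs` bounds every entry. [this work] -/
theorem abs_getD_le_maxAbs (l : List ℤ) (i : ℕ) : |l.getD i 0| ≤ (maxAbs l : ℤ) := by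
  induction l generalizing i with
  | nil => simp [maxAbs]
  | cons z l ih =>
    unfold maxAbs
    rw [List.foldr_cons]
    cases i with
    | zero => simp only [List.getD_cons_zero]; push_cast; exact le_trans (le_of_eq (Int.natCast_natAbs z).symm) (by exact_mod_cast le_max_left _ _)
    | succ i =>
      simp only [List.getD_cons_succ]
      refine (ih i).trans ?_
      unfold maxAbs
      exact_mod_cast le_max_right _ _

/-- For fixed `g`, at most one `h` has `key g h = k`. [this work] -/
theorem key_inj_right {m : ℕ} (g h₁ h₂ : Fin m → Bool) (k : Fin m → Fin 3)
    (e₁ : key g h₁ = k) (e₂ : key g h₂ = k) : h₁ = h₂ := by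
  funext i
  have a := congrFun e₁ i
  have b := congrFun e₂ i
  rw [← b] at a
  unfold key at a
  revert a
  cases g i <;> cases h₁ i <;> cases h₂ i <;> simp [bkey]

/-- **Fibre-sum bound**: `|pcoef A B k| ≤ 2^m · max|A| · max|B|` for list tables. [this work] -/
theorem abs_pcoef_le {m : ℕ} (lA lB : List ℤ) (k : Fin m → Fin 3) :
    |pcoef (tabOf (m := m) lA) (tabOf lB) k| ≤ 2 ^ m * ((maxAbs lA : ℤ) * maxAbs lB) := by
  unfold pcoef
  have hone : ∀ g : Fin m → Bool,
      |∑ h, (if key g h = k then tabOf lA g * tabOf lB h else 0)| ≤ (maxAbs lA : ℤ) * maxAbs lB := by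
    intro g
    by_cases hex : ∃ h, key g h = k
    · obtain ⟨h₀, hh₀⟩ := hex
      rw [Finset.sum_eq_single h₀ (fun h _ hne => if_neg fun e => hne (key_inj_right g h h₀ k e hh₀))
        (fun hn => absurd (Finset.mem_univ _) hn), if_pos hh₀, abs_mul]
      exact mul_le_mul (abs_getD_le_maxAbs lA _) (abs_getD_le_maxAbs lB _) (abs_nonneg _) (by positivity)
    · push Not at hex
      rw [Finset.sum_eq_zero (fun h _ => if_neg (hex h)), abs_zero]
      positivity
  refine (Finset.abs_sum_le_sum_abs _ _).trans ((Finset.sum_le_sum fun g _ => hone g).trans ?_)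
  rw [Finset.sum_const, Finset.card_univ, Fintype.card_fun, Fintype.card_bool, Fintype.card_fin,
    nsmul_eq_mul]
  push_cast
  rfl

/-- `maxAbs` of a list of naturals cast to `ℤ`. [this work] -/
theorem maxAbs_map_natCast (l : List ℕ) : maxAbs (l.map ((↑) : ℕ → ℤ)) = l.foldr max 0 := by
  induction l with
  | nil => rfl
  | cons x l ih => simp only [maxAbs, List.map_cons, List.foldr_cons, Int.natAbs_natCast] at ih ⊢; rw [ih]

/-- The positive/negative part split of a list table. [this work] -/
theorem tabOf_pos_sub_neg {m : ℕ} (l : List ℤ) (g : Fin m → Bool) :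
    tabOf ((posPart l).map ((↑) : ℕ → ℤ)) g - tabOf ((negPart l).map ((↑) : ℕ → ℤ)) g = tabOf l g := by
  unfold tabOf posPart negPart
  simp only [List.getD_eq_getElem?_getD, List.getElem?_map, List.map_map]
  cases l[enc2 g]? with
  | none => simp
  | some z =>
    simp only [Option.map_some, Option.getD_some, Function.comp]
    omega

/-- `KR` is additive. [this work] -/
theorem KR_sub {m : ℕ} (M : ℕ) (A B : (Fin m → Bool) → ℤ) :
    KR M (fun g => A g - B g) = KR M A - KR M B := by
  unfold KR; rw [← Finset.sum_sub_distrib]; exact Finset.sum_congr rfl fun g _ => by ring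

/-- **Correctness of `krZ`.** [this work] -/
theorem krZ_eq {m : ℕ} (s : ℕ) (l : List ℤ) (hl : l.length = 2 ^ m) :
    krZ s m l = KR (2 ^ s) (tabOf (m := m) l) := by
  unfold krZ
  rw [krN_eq s m _ (by unfold posPart; rw [List.length_map, hl]),
    krN_eq s m _ (by unfold negPart; rw [List.length_map, hl]), ← KR_sub]
  congr 1
  funext g
  exact tabOf_pos_sub_neg l g

/-- Geometric series for the offset. [folklore] -/
theorem off_eq (s L : ℕ) (hs : 0 < s) :
    ((2 : ℤ) ^ (s * L) - 1) / (2 ^ s - 1) = ∑ j ∈ Finset.range L, ((2 : ℤ) ^ s) ^ j := by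
  have hne : (2 : ℤ) ^ s - 1 ≠ 0 := by
    have : (2 : ℤ) ≤ 2 ^ s := by
      calc (2:ℤ) = 2 ^ 1 := by norm_num
        _ ≤ 2 ^ s := pow_le_pow_right₀ (by norm_num) hs
    omega
  refine Int.ediv_eq_of_eq_mul_right hne ?_
  rw [pow_mul, ← geom_sum_mul, mul_comm]

set_option maxHeartbeats 800000 in
/-- **Soundness of the box-certificate check.**  If `boxCheck` accepts, then at every weight vector
strictly inside the box with `E N > 4` (relays = `rel`, observer `o`), the probability of
`{1 ≤ N ≤ 2}` is at most `t` whenever every listed relay–relay cut has probability at most `t`. [this work] -/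
theorem boxCheck_sound (o : Fin n) (rel : List (Fin n)) (hrel : rel.Nodup) (pairs : List (Fin n × Fin n))
    (φ : Fin (mE n) → Fin 3) (s : ℕ) (lam : List (List ℕ)) (cc : List ℕ)
    (hc : boxCheck n o rel pairs φ s lam cc = true)
    (w : Sym2 (Fin n) → unitInterval) (hbox : ∀ i, loOf (φ i) < xOf w i ∧ xOf w i < hiOf (φ i))
    (hEN : 4 < ∑ a ∈ rel.toFinset, (prodBernoulli w).real (openConn o a))
    (t : ℝ) (hcut : ∀ p ∈ pairs, (prodBernoulli w).real (openConn p.1 p.2)ᶜ ≤ t) :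
    (prodBernoulli w).real {ω : BondConfig (Fin n) |
        1 ≤ (rel.toFinset.filter fun a => ω ∈ openConn o a).card ∧
          (rel.toFinset.filter fun a => ω ∈ openConn o a).card ≤ 2} ≤ t := by
  -- unpack the check
  unfold boxCheck at hc
  simp only [rawSepLow_eq_map, rawH_eq_map, Bool.and_eq_true, decide_eq_true_eq, List.all_eq_true,
    List.any_eq_true] at hc
  obtain ⟨⟨⟨⟨⟨⟨⟨hs, hlen⟩, hall⟩, hcc⟩, hbnd⟩, hany⟩, hZoff⟩, hland⟩ := hc
  have hab : ∀ i, loOf (φ i) < hiOf (φ i) := fun i => loOf_lt_hiOf (φ i)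
  -- box coordinates
  set u : Fin (mE n) → ℝ := fun i => (xOf w i - loOf (φ i)) / (hiOf (φ i) - loOf (φ i)) with hu
  have hu01 : ∀ i, 0 < u i ∧ u i < 1 := fun i =>
    ⟨div_pos (sub_pos.2 (hbox i).1) (sub_pos.2 (hab i)),
      (div_lt_one (sub_pos.2 (hab i))).2 (sub_lt_sub_right (hbox i).2 _)⟩
  have hucube : InCube u := fun i => ⟨(hu01 i).1.le, (hu01 i).2.le⟩
  have hxu : (fun i => loOf (φ i) + (hiOf (φ i) - loOf (φ i)) * u i) = xOf w := by
    funext i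
    simp only [hu]
    field_simp [(sub_pos.2 (hab i)).ne']
    ring
  -- the index type of pairs and the tables
  set P := pairs.length with hP
  let Tl : Fin P → List ℤ := fun k => boxTr (mE n) (fun i => phiZ (φ i)) (rawSepLow n o rel (pairs[k]).1 (pairs[k]).2)
  let Hl : List ℤ := boxTr (mE n) (fun i => phiZ (φ i)) (rawH n o rel)
  let Λ : Fin P → (Fin (mE n) → Bool) → ℤ := fun k => tabOf ((lam.getD k []).map ((↑) : ℕ → ℤ))
  let T : Fin P → (Fin (mE n) → Bool) → ℤ := fun k => tabOf (Tl k)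
  let C : (Fin (mE n) → Bool) → ℤ := tabOf (cc.map ((↑) : ℕ → ℤ))
  let H : (Fin (mE n) → Bool) → ℤ := tabOf Hl
  have hTlen : ∀ k : Fin P, (Tl k).length = 2 ^ mE n := fun k =>
    length_boxTr (mE n) (fun i => phiZ (φ i)) _ (length_rawSepLow o rel _ _)
  have hHlen : Hl.length = 2 ^ mE n := length_boxTr (mE n) (fun i => phiZ (φ i)) _ (length_rawH o rel)
  have hlamlen : ∀ k : Fin P, (lam.getD k []).length = 2 ^ mE n := fun k => by
    have hk : (k : ℕ) < lam.length := by rw [hlen]; exact k.2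
    rw [List.getD_eq_getElem?_getD, List.getElem?_eq_getElem hk, Option.getD_some]
    exact hall _ (List.getElem_mem hk)
  -- Step A: all integer fibre sums are nonnegative
  have hmaxNat : ∀ l : List ℕ, (maxAbs (l.map ((↑) : ℕ → ℤ)) : ℤ) = (maxNat l : ℤ) := fun l => by
    rw [maxAbs_map_natCast]; rfl
  have hA : ∀ k, 0 ≤ certCoefZ Λ T C H k := by
    have hoff : ((2 : ℤ) ^ (s - 1) * ((2 ^ (s * 3 ^ mE n) - 1) / (2 ^ s - 1))) = (maskN s (3 ^ mE n) : ℤ) := by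
      rw [off_eq s _ hs, Finset.mul_sum, maskN_eq_sum s hs]
    rw [hoff, Int.toNat_natCast] at hland
    rw [hoff] at hZoff
    refine certCoefZ_nonneg_of_digit_ge hs ?_ ((_ : ℤ) + _).toNat ?_
      (fun j hj => digit_ge_of_land s hs (3 ^ mE n) _ hland j hj)
    · -- coefficient bound
      intro k
      have h1 : |certCoefZ Λ T C H k| ≤
          ∑ q : Fin P, 2 ^ mE n * ((maxAbs ((lam.getD q []).map ((↑) : ℕ → ℤ)) : ℤ) * maxAbs (Tl q)) +
            2 ^ mE n * ((maxAbs (cc.map ((↑) : ℕ → ℤ)) : ℤ) * maxAbs Hl) := by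
        unfold certCoefZ
        refine (abs_sub _ _).trans (add_le_add ((Finset.abs_sum_le_sum_abs _ _).trans
          (Finset.sum_le_sum fun q _ => abs_pcoef_le _ _ k)) (abs_pcoef_le _ _ k))
      have h2 : (∑ q : Fin P, 2 ^ mE n * ((maxAbs ((lam.getD q []).map ((↑) : ℕ → ℤ)) : ℤ) * maxAbs (Tl q)) +
            2 ^ mE n * ((maxAbs (cc.map ((↑) : ℕ → ℤ)) : ℤ) * maxAbs Hl) : ℤ) =
          ((2 ^ mE n * ((List.ofFn fun k : Fin P => maxNat (lam.getD k []) * maxAbs (Tl k)).sum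
            + maxNat cc * maxAbs Hl) : ℕ) : ℤ) := by
        rw [List.sum_ofFn]
        push_cast
        simp only [hmaxNat, mul_add, Finset.mul_sum]
      rw [h2] at h1
      exact lt_of_le_of_lt h1 (by exact_mod_cast hbnd)
    · -- the number
      rw [Int.toNat_of_nonneg hZoff]
      congr 1
      · unfold certZ
        rw [List.sum_ofFn]
        congr 1
        · refine Finset.sum_congr rfl fun k _ => ?_
          rw [krN_eq s (mE n) _ (hlamlen k), krZ_eq s _ (hTlen k)]
        · rw [krN_eq s (mE n) _ hcc, krZ_eq s _ hHlen]
      · rw [maskN_eq_sum s hs, Finset.sum_range]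
  -- Step B: the certificate form is nonnegative at `u`
  have hF : 0 ≤ certForm (fun k g => (Λ k g : ℝ)) (fun k g => (T k g : ℝ)) (fun g => (C g : ℝ))
      (fun g => (H g : ℝ)) u :=
    certForm_nonneg (fun k => by rw [certCoef_cast]; exact_mod_cast hA k) hucube
  -- Step C: identify the factors
  set μ := prodBernoulli w with hμ
  set A := rel.toFinset with hAset
  set Lo : ℝ := μ.real {ω : BondConfig (Fin n) | 1 ≤ (A.filter fun a => ω ∈ openConn o a).card ∧
      (A.filter fun a => ω ∈ openConn o a).card ≤ 2} with hLo
  set D : Fin P → ℝ := fun k => μ.real (openConn (pairs[k]).1 (pairs[k]).2)ᶜ with hD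
  set EN : ℝ := ∑ a ∈ A, μ.real (openConn o a) with hENdef
  have hT : ∀ k : Fin P, ML (fun g => (T k g : ℝ)) u = 2 ^ mE n * (D k - Lo) := by
    intro k
    have e1 : (fun g => (T k g : ℝ)) = fun g => 2 ^ mE n * boxT (fun i => loOf (φ i)) (fun i => hiOf (φ i))
        (fun h => (tabOf (rawSepLow n o rel (pairs[k]).1 (pairs[k]).2) h : ℝ)) g := by
      funext g; exact boxTr_phiZ_eq φ _ (length_rawSepLow o rel _ _) g
    rw [e1, ML_smul, ← ML_box, hxu]
    congr 1
    have e2 : (fun h => (tabOf (rawSepLow n o rel (pairs[k]).1 (pairs[k]).2) h : ℝ)) =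
        fun h => (if connB h (pairs[k]).1 (pairs[k]).2 then (0 : ℝ) else 1) -
          (if 1 ≤ Ncount h o A ∧ Ncount h o A ≤ 2 then (1 : ℝ) else 0) := by
      funext h
      rw [tabOf_rawSepLow o rel hrel _ _ h]
      push_cast
      split_ifs <;> simp
    rw [e2, ML_sub, ← real_sep_eq_ML, ← real_low_eq_ML]
  have hH : ML (fun g => (H g : ℝ)) u = 2 ^ mE n * (EN - 4) := by
    have e1 : (fun g => (H g : ℝ)) = fun g => 2 ^ mE n * boxT (fun i => loOf (φ i)) (fun i => hiOf (φ i))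
        (fun h => (tabOf (rawH n o rel) h : ℝ)) g := by
      funext g; exact boxTr_phiZ_eq φ _ (length_rawH o rel) g
    rw [e1, ML_smul, ← ML_box, hxu]
    congr 1
    have e2 : (fun h => (tabOf (rawH n o rel) h : ℝ)) = fun h => (Ncount h o A : ℝ) - 4 := by
      funext h; rw [tabOf_rawH o rel hrel h]; push_cast; rfl
    rw [e2, ML_sub, ← meanCount_eq_ML, ML_const]
  -- Step D: conclude
  have hlam_nonneg : ∀ k : Fin P, 0 ≤ ML (fun g => (Λ k g : ℝ)) u := fun k =>
    ML_nonneg (fun g => by exact_mod_cast tabOf_natCast_nonneg _ g) hucube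
  have hc_nonneg : 0 ≤ ML (fun g => (C g : ℝ)) u :=
    ML_nonneg (fun g => by exact_mod_cast tabOf_natCast_nonneg _ g) hucube
  have hpos : 0 < ∑ k : Fin P, ML (fun g => (Λ k g : ℝ)) u := by
    obtain ⟨l, hl, x, hx, hxpos⟩ := hany
    obtain ⟨i, hi, rfl⟩ := List.getElem_of_mem hl
    have hiP : i < P := by rw [← hlen]; exact hi
    have hk : 0 < ML (fun g => (Λ ⟨i, hiP⟩ g : ℝ)) u := by
      have : lam.getD i [] = lam[i] := by
        rw [List.getD_eq_getElem?_getD, List.getElem?_eq_getElem hi, Option.getD_some]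
      show 0 < ML (fun g => (tabOf ((lam.getD (⟨i, hiP⟩ : Fin P) []).map ((↑) : ℕ → ℤ)) g : ℝ)) u
      simp only [this]
      exact ML_pos_of_entry _ (this ▸ hlamlen ⟨i, hiP⟩) ⟨x, hx, hxpos⟩ hu01
    exact lt_of_lt_of_le hk (Finset.single_le_sum (fun k _ => hlam_nonneg k) (Finset.mem_univ _))
  have hEpos : 0 ≤ EN - 4 := by linarith
  have hbracket : 0 ≤ ∑ k : Fin P, ML (fun g => (Λ k g : ℝ)) u * (D k - Lo) -
      ML (fun g => (C g : ℝ)) u * (EN - 4) := by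
    have : certForm (fun k g => (Λ k g : ℝ)) (fun k g => (T k g : ℝ)) (fun g => (C g : ℝ))
        (fun g => (H g : ℝ)) u = 2 ^ mE n * (∑ k : Fin P, ML (fun g => (Λ k g : ℝ)) u * (D k - Lo) -
          ML (fun g => (C g : ℝ)) u * (EN - 4)) := by
      unfold certForm
      simp_rw [hT, hH]
      have hk : ∀ k : Fin P, ML (fun g => (Λ k g : ℝ)) u * (2 ^ mE n * (D k - Lo)) =
          2 ^ mE n * (ML (fun g => (Λ k g : ℝ)) u * (D k - Lo)) := fun k => by ring
      simp_rw [hk, ← Finset.mul_sum]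
      ring
    rw [this] at hF
    exact (mul_nonneg_iff_of_pos_left (by positivity)).1 hF
  have ht' : ∀ k : Fin P, D k ≤ t := fun k => hcut _ (List.getElem_mem k.2)
  exact le_of_certificate hlam_nonneg hpos hc_nonneg hEpos hbracket ht'

end Summit.CriticalPhenomena.PercolationContinuityZ3.Theorems.OneCutCert
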